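import Summits.QuantumFields.BalabanUV.Beta.FP.StepRecursionFeedNestedCompDoorPairing
import Summits.QuantumFields.BalabanUV.Beta.FP.TowerK2bDoorPairingSummable
import Summits.QuantumFields.BalabanUV.Beta.FP.TowerK2bDoorReadoutSummable

/-!
# `BalabanUV.Beta.FP.StepRecursionFeedNestedCompDoorPairingSummable` — road «FP» for binder row D1: **THE SUMMABLE CUT OF THE PAIRING SOCKET — the END at the base
# (and at every storey) with the door tadpole displayed as the covariant symmetrised pairing ON `ℤ⁴` WITH NO WINDOW LETTERS: read-out and door-word columns with
# absolutely summable second moments (an4's `AbsMoment₂`), the (U)-letter `hΘ` as a lattice sum, and the read-out columns' vanishing MONOPOLE `hS0` and DIPOLES `hS1`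
# displayed — an4's three folds discharged BY NAME from an2's PART 43 `TowerK2bDoorPairingSummable`** (an2 A-6 l.68603 LOCATED: the finite-support letters of
# `…CompDoorPairing` are a model; THIS is the record-inhabitable socket; `…CompDoorMoments` p659244 BY NAME)

WHY.  `…CompDoorPairing` (p663039) discharges the END's folds from PART 41∕42 under FINITE windows and support letters — a MODEL (truncation ∕ Engine C's torus window):
`Ŝ = wPhi` and the door-word columns decay but are nowhere zero (K2L-DTAD §3; an2 A-6; E-FP-52-2).  an2's PART 43∕44 re-prove the pairing bookkeeping on `ℤᵈ` under SUMMABILITY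
letters only (`AbsMoment₂` columns, covariance verbatim; `∑' X = 0` under `hΘ`, `HasSum (c·X) 0` under `hΘ ∧ hS0`, `HasSum (c c′·X) 0` under `hΘ ∧ hS0 ∧ hS1`; and `hS0 hS1` from
POINTWISE co-closedness + reflections).  THIS FILE plugs them into `…CompDoorMoments` (p659244): the coordinates `c ρ z = z_ρ` have linear growth (`abs_coord_le_l1`, constant 1), so
only record-shaped letters are displayed — `hSa hτa hS hτ`, (U) `hΘ`, and either the read-out monopole∕dipole rows `hS0 hS1` (§2∕§3) or the letters (C)(R) themselves (§4∕§5) — plus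
the identification `hX` with a lattice inner sum.  Consumer class: composition BY NAME; no law, no v10, nothing on the H-side (policy SPEC-64 §10 (4) ∕ §12).

WHAT.  Blocking `Lc` (`[NeZero Lc]`, `Odd Lc`), dimension four, `G := Site (3+1) = ℤ⁴`, `D := Fin (3+1)`, gauge-column spaces `V` (base) ∕ `V j` (storeys).
* §1 [folklore] `abs_coordHom_le_l1` (the displayed coordinates have linear growth, constant `1`); `tsum_tadpole_eq_zero_of_tsum` (one-token bridge for the M0 row).
* §2 [folklore] **`d1Tel_JcComp_ctr_nested_of_fedW_pairingSummable_fed_wStep`** (+ `d1Sum_…` twin) — BASE-ONLY: p659244 §3's rows `hWΔ₂ hlawΔ hF₁ htrΔ hG hT0 hT1 hDΔtr` VERBATIM;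
  the base folds `hM0₁ hM1₁ hM2₁` (resp. `hM2F₁`) REPLACED by `S τ lam`, `c` (`hcz`), `hS hτ hSa hτa`, (U) `hΘ`, `hS0`, `hS1`, `hX`.
* §3 [folklore] **`d1Tel_JcComp_nested_of_fedW_pairingSummable_wStep`** — PER-STOREY (p659244 §2 shape, general roots `Rt`, NO covariance row): the same letters storey-indexed.
* §4 [folklore] **`d1Tel∕d1Sum_JcComp_ctr_nested_of_fedW_pairingCoclosed_fed_wStep`** — BASE-ONLY WITH (C)(R) DISPLAYED (an2 PART 44 `TowerK2bDoorReadoutSummable` BY NAME): `hS0 hS1`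
  REPLACED by unit steps `e` (`hce : c ρ (e κ) = [κ = ρ]`), (C) `hdiv : Σ_κ (S ν 0 κ y − S ν 0 κ (y − e κ)) = 0` POINTWISE on `ℤ⁴`, (R) mirrors `R ν ρ : ℤ⁴ ≃ ℤ⁴` fixing the components
  `κ ≠ ρ` of `Ŝ_{(ν,0)}` (`hRA`) and flipping `c ρ` affinely (`hRc`) — no window-preservation letter on `ℤ⁴`; inside `tsum_col_eq_zero_of_coclosed` ∕ `tsum_dipoles_eq_zero_of_coclosed_of_reflect`.
* §5 [folklore] **`d1Tel_JcComp_nested_of_fedW_pairingCoclosed_wStep`** — PER-STOREY WITH (C)(R) DISPLAYED (storey-indexed `hdiv j`, `R j ν ρ`, `k j ν ρ`).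
[folklore] composition BY NAME + one `abs` inequality by name; no `def`, no `def … : Prop`, nothing cited, 0 sorry.  Every displayed row is a HYPOTHESIS; `hΘ hS0 hS1 hX hSa hτa`
NOT discharged here (the row's LEMMA U ∕ C ∕ R + (T2), PART 44 for the `∑'` forms of C∕R); nothing of the dictionary ∕ Bałaban's asserted, valued or discharged; NO moment claimed to
vanish AT THE RECORD; the STEPS of §2 still ride on `hDΔtr` (G3); targets `D1Tel`∕`D1Sum` UNCHANGED; NOT a law file; no existing file touched.

HONEST DEPENDENCY (page 1, mandatory): continuum YM on T⁴ ⇐ BetaPertH ∧ nine spine estimates (0/9 proved); BetaPertH ⇐ (D1) ∧ (D4) ∧ CAP+tail;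
G-an2-4 gates asym, D1 and NE2/3/4.  HONEST FRAMING (cell contract, verbatim): «discharging `BetaPertH` makes Bałaban's UV stability UNCONDITIONAL —
a real constructive-QFT result; it is NOT the continuum limit and NOT the Clay problem.»  ABSOLUTE RULE (cell charter, verbatim): «No internally-minted
statement may enter as a cited fact. Every hypothesis is either kernel-proved in this package or a verbatim quotation of a PUBLISHED theorem with page
reference. The manuscript(s) under audit are NOT citable for their own disputed steps — they are the thing under adjudication; programme-internal
(2001/route/tribunal) claims are never citable.»  0 estimates; 0∕4 row-D1 binders (hW, hR, D1Tel, D1Rep); ROOT M‴ p325680 untouched; NOT (C1), NOT (L2′)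
beyond `hN`'s name, NOT (T-ID), NOT SDF, NOT D1, NEVER «G-an2-4 closed», NOT BetaPertH, NOT continuum, NOT Clay.  Road «FP» OWNER, b2b-balaban-beta-d1-p3
gen 52, 2026-08-28.  No existing file touched.
-/

noncomputable section

namespace Summit.QuantumFields.BalabanUV.Beta.FP.StepRecursionFeedNestedCompDoorPairingSummable

open Finset
open Literature.MathematicalPhysics.QuantumFieldTheory
open Literature.MathematicalPhysics.QuantumFieldTheory.Balaban1983to89
open Literature.MathematicalPhysics.QuantumFieldTheory.Balaban1983to89.Beta
open Literature.MathematicalPhysics.QuantumFieldTheory.Balaban1983to89.B12Sec2to5 (l1 abs_coord_le_l1)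
open DecimatedMomentSummable (AbsMoment₂)
open DressedMomentNormalisation (EKer dressedEntry)
open ExpKernelCalculus (Site MKer tadpole hessKer VertexFamily₂)
open OneStepResolventKernel (Fib JetData)
open OneStepKernelFamily (TshotOf TbalOf D1Tel)
open HessianTelescopingKKT (wStep)
open StepDriftWitness (D1Sum)
open Summit.QuantumFields.BalabanUV.Beta.SymSecondOrderTablesAn1 (symTablesAn1S2)
open Summit.QuantumFields.BalabanUV.Beta.CombChartJointEnd (JsB12CombShSym)
open Summit.QuantumFields.BalabanUV.Beta.CompositeOneShotJetData (Roots Pins JcComp AN VN WN)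
open Summit.QuantumFields.BalabanUV.Beta.FP.StepRecursionFeedNestedCompDoorMoments
  (d1Tel_JcComp_nested_of_fedW_moments_wStep d1Tel_JcComp_ctr_nested_of_fedW_moments_fed_wStep d1Sum_JcComp_ctr_nested_of_fedW_moments_fed_wStep)
open Summit.QuantumFields.BalabanUV.Beta.FP.StepRecursionFeedNestedCompDoorPairing (tsum_weight_tadpole_eq_zero_of_hasSum)
open Summit.QuantumFields.BalabanUV.Beta.FP.TowerK2bDoorPairingSummable
  (tsum_symPairing_eq_zero tsum_firstMoment_symPairing_eq_zero_of_colSums_eq_zero tsum_secondMoment_symPairing_eq_zero_of_dipoles_eq_zero)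
open Summit.QuantumFields.BalabanUV.Beta.FP.TowerK2bDoorReadoutSummable (tsum_col_eq_zero_of_coclosed tsum_dipoles_eq_zero_of_coclosed_of_reflect)

/-! ## §1 Letters: the lattice coordinates have linear growth; the M0 bridge -/

section Letters
/-- [folklore] a displayed coordinate hom `c ρ` with `c ρ z = z_ρ` has linear growth with constant `1`: `|c ρ z| ≤ 1·|z|₁` (`B12Sec2to5.abs_coord_le_l1`). -/
theorem abs_coordHom_le_l1 {d : ℕ} (c : Fin d → (Fin d → ℤ) →+ ℝ) (hcz : ∀ (ρ : Fin d) (z : Fin d → ℤ), c ρ z = (z ρ : ℝ)) (ρ : Fin d)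
    (z : Fin d → ℤ) : |c ρ z| ≤ 1 * l1 z := by
  rw [hcz, one_mul]; exact abs_coord_le_l1 z ρ

/-- [folklore] the M0 bridge: `∑' z, X z = 0` and `τ = X` pointwise ⟹ `∑' z, τ z = 0`. -/
theorem tsum_tadpole_eq_zero_of_tsum {G : Type*} {X τ : G → ℝ} (h : ∑' z, X z = 0) (hX : ∀ z, τ z = X z) : ∑' z, τ z = 0 := by
  rw [show τ = X from funext hX]; exact h

end Letters

/-! ## §2 Base-only shape, summable cut -/

section BaseSummable

variable {Lc : ℕ} [NeZero Lc] {FF FG : Type*} [Fintype FF] [Fintype FG] {V : Type*} [AddCommGroup V] [Module ℝ V]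

/-- [folklore] **THE BASE END, SUMMABLE CUT** (SPEC-64 §12; an2 A-6): p659244 §3's `𝒲Δ hWΔ₂ hlawΔ hF₁ htrΔ hG hT0 hT1 hDΔtr` VERBATIM; at the base `S τ lam`, `c ρ` (`hcz`), covariance
`hS hτ`, summability `hSa hτa`, (U) `hΘ`, the read-out monopole `hS0` and dipoles `hS1` (LEMMA C ∕ R's conclusions) and the identification `hX` (lattice inner sum) ⟹ `D1Tel`. -/
theorem d1Tel_JcComp_ctr_nested_of_fedW_pairingSummable_fed_wStep (hLc : Odd Lc) (N : ℕ) (cΛ cB : ℝ) (P : Pins)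
    (AF : ℕ → MKer 4 FF) (𝒱F : ℕ → Fin 4 → (Fin 4 → ℤ) → MKer 4 FF) (𝒲F : ℕ → Fin 4 → (Fin 4 → ℤ) → Fin 4 → (Fin 4 → ℤ) → MKer 4 FF)
    (AG : ℕ → MKer 4 FG) (𝒱G : ℕ → Fin 4 → (Fin 4 → ℤ) → MKer 4 FG) (𝒲G : ℕ → Fin 4 → (Fin 4 → ℤ) → Fin 4 → (Fin 4 → ℤ) → MKer 4 FG)
    (𝒲Δ : ℕ → Fin (3 + 1) → Site (3 + 1) → Fin (3 + 1) → Site (3 + 1) → MKer (3 + 1) (Fib 3))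
    (hWΔ₂ : ∀ j : ℕ, ∃ Cw δw : ℝ, 0 < δw ∧ VertexFamily₂ (𝒲Δ j) (Lc ^ (j + 1)) Cw δw)
    (hlawΔ : ∀ j : ℕ, 1 ≤ j → ∀ (μ ν : Fin 4) (z : Fin 4 → ℤ),
      hessKer (AN (Roots.ctr Lc) j) (VN (Roots.ctr Lc) P j) (WN (Roots.ctr Lc) P j + 𝒲Δ j) μ ν z
        = hessKer (AF j) (𝒱F j) (𝒲F j) μ ν z + hessKer (AG j) (𝒱G j) (𝒲G j) μ ν z)
    (hF₁ : ∀ (μ ν : Fin 4) (z : Fin 4 → ℤ),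
      hessKer (AF 1) (𝒱F 1) (𝒲F 1) μ ν z
        = (Lc : ℝ) ^ 8 * dressedEntry (wStep Lc 1) (TshotOf Lc (JcComp hLc N cΛ cB (Roots.ctr Lc) P) 1) ((Lc : ℤ) • z) μ ν)
    (htrΔ : ∀ j : ℕ, 1 ≤ j → ∀ (μ ν : Fin 4) (z : Fin 4 → ℤ),
      hessKer (AF (j + 1)) (𝒱F (j + 1)) (𝒲F (j + 1)) μ ν z
        = (Lc : ℝ) ^ 8 * dressedEntry (wStep Lc (j + 1))
            (hessKer (AN (Roots.ctr Lc) j) (VN (Roots.ctr Lc) P j) (WN (Roots.ctr Lc) P j + 𝒲Δ j)) ((Lc : ℤ) • z) μ ν)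
    (hG : ∀ j : ℕ, 1 ≤ j → ∀ (μ ν : Fin 4) (z : Fin 4 → ℤ),
      hessKer (AG j) (𝒱G j) (𝒲G j) μ ν z = TbalOf Lc (JsB12CombShSym hLc N (symTablesAn1S2 3 Lc cΛ) cΛ cB) j μ ν z)
    (hT0 : ∀ j (c e : Fin 4), HasSum (TbalOf Lc (JsB12CombShSym hLc N (symTablesAn1S2 3 Lc cΛ) cΛ cB) j c e) 0)
    (hT1 : ∀ j (c e ρ : Fin 4), HasSum (fun t : Fin 4 → ℤ => t ρ • TbalOf Lc (JsB12CombShSym hLc N (symTablesAn1S2 3 Lc cΛ) cΛ cB) j c e t) 0)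
    (hDΔtr : ∀ j : ℕ, 1 ≤ j → ∀ (μ ν : Fin 4) (z : Fin 4 → ℤ),
      -(1 / 2 : ℝ) * tadpole (AN (Roots.ctr Lc) (j + 1)) (𝒲Δ (j + 1) μ 0 ν z)
        = (Lc : ℝ) ^ 8 * dressedEntry (wStep Lc (j + 1))
            (fun c e t => -(1 / 2 : ℝ) * tadpole (AN (Roots.ctr Lc) j) (𝒲Δ j c 0 e t)) ((Lc : ℤ) • z) μ ν)
    -- THE DOOR TADPOLE AT THE BASE AS THE COVARIANT SYMMETRISED PAIRING ON ℤ⁴ (summable cut)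
    (S : Fin (3 + 1) → Site (3 + 1) → Fin (3 + 1) → Site (3 + 1) → ℝ) (τ : Fin (3 + 1) → Site (3 + 1) → V →ₗ[ℝ] ℝ) (lam : Fin (3 + 1) → Site (3 + 1) → V)
    (c : Fin (3 + 1) → Site (3 + 1) →+ ℝ) (hcz : ∀ (ρ : Fin (3 + 1)) (z : Site (3 + 1)), c ρ z = (z ρ : ℝ))
    (hS : ∀ (ν : Fin (3 + 1)) (z : Site (3 + 1)) (κ : Fin (3 + 1)) (y : Site (3 + 1)), S ν z κ y = S ν 0 κ (y - z))
    (hτ : ∀ (κ : Fin (3 + 1)) (y : Site (3 + 1)) (μ : Fin (3 + 1)) (z : Site (3 + 1)), τ κ y (lam μ z) = τ κ (y - z) (lam μ 0))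
    (hSa : ∀ (ν κ : Fin (3 + 1)), AbsMoment₂ (fun w => S ν 0 κ w)) (hτa : ∀ (κ μ : Fin (3 + 1)), AbsMoment₂ (fun y => τ κ y (lam μ 0)))
    -- (U) no door word on the summed gauge column; LEMMA C ∕ R's conclusions: no monopole, no dipole of the read-out columns
    (hΘ : ∀ (κ μ : Fin (3 + 1)), ∑' y, τ κ y (lam μ 0) = 0)
    (hS0 : ∀ (ν κ : Fin (3 + 1)), ∑' w, S ν 0 κ w = 0)
    (hS1 : ∀ (ρ ν κ : Fin (3 + 1)), ∑' w, c ρ w * S ν 0 κ w = 0)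
    -- THE IDENTIFICATION ((T2)'s shape), inner sum a lattice sum
    (hX : ∀ (μ ν : Fin (3 + 1)) (z : Site (3 + 1)),
      tadpole (AN (Roots.ctr Lc) 1) (𝒲Δ 1 μ 0 ν z) = ∑ κ, ∑' y, (S ν z κ y * τ κ y (lam μ 0) + S μ 0 κ y * τ κ y (lam ν z))) :
    D1Tel Lc (JsB12CombShSym hLc N (symTablesAn1S2 3 Lc cΛ) cΛ cB) (JcComp hLc N cΛ cB (Roots.ctr Lc) P) := by
  have hc1 : ∀ (ρ : Fin (3 + 1)) (z : Site (3 + 1)), |c ρ z| ≤ 1 * l1 z := abs_coordHom_le_l1 c hcz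
  refine d1Tel_JcComp_ctr_nested_of_fedW_moments_fed_wStep hLc N cΛ cB P AF 𝒱F 𝒲F AG 𝒱G 𝒲G 𝒲Δ hWΔ₂ hlawΔ hF₁ htrΔ hG hT0 hT1 hDΔtr
    (fun μ ν => tsum_tadpole_eq_zero_of_tsum (tsum_symPairing_eq_zero S τ lam hS hτ hSa hτa hΘ μ ν) (hX μ ν))
    (fun μ ν ρ => ?_) (fun κ l μ ν => ?_)
  · have h := tsum_firstMoment_symPairing_eq_zero_of_colSums_eq_zero S τ lam hS hτ hSa hτa hΘ hS0 (c ρ) zero_le_one (hc1 ρ) μ ν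
    simp only [hcz] at h
    exact tsum_weight_tadpole_eq_zero_of_hasSum h (hX μ ν)
  · have h := tsum_secondMoment_symPairing_eq_zero_of_dipoles_eq_zero S τ lam hS hτ hSa hτa hΘ hS0 (c κ) (c l) zero_le_one zero_le_one
      (hc1 κ) (hc1 l) (hS1 κ) (hS1 l) μ ν
    simp only [hcz] at h
    exact tsum_weight_tadpole_eq_zero_of_hasSum h (hX μ ν)

/-- [folklore] **THE READ-OUT-LEVEL TWIN, SUMMABLE CUT** (channel `(μ, ν)`) ⟹ `D1Sum Lc Js (JcComp … (Roots.ctr Lc) P) μ ν`. -/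
theorem d1Sum_JcComp_ctr_nested_of_fedW_pairingSummable_fed_wStep (hLc : Odd Lc) (N : ℕ) (cΛ cB : ℝ) (P : Pins)
    (AF : ℕ → MKer 4 FF) (𝒱F : ℕ → Fin 4 → (Fin 4 → ℤ) → MKer 4 FF) (𝒲F : ℕ → Fin 4 → (Fin 4 → ℤ) → Fin 4 → (Fin 4 → ℤ) → MKer 4 FF)
    (AG : ℕ → MKer 4 FG) (𝒱G : ℕ → Fin 4 → (Fin 4 → ℤ) → MKer 4 FG) (𝒲G : ℕ → Fin 4 → (Fin 4 → ℤ) → Fin 4 → (Fin 4 → ℤ) → MKer 4 FG)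
    (𝒲Δ : ℕ → Fin (3 + 1) → Site (3 + 1) → Fin (3 + 1) → Site (3 + 1) → MKer (3 + 1) (Fib 3))
    (hWΔ₂ : ∀ j : ℕ, ∃ Cw δw : ℝ, 0 < δw ∧ VertexFamily₂ (𝒲Δ j) (Lc ^ (j + 1)) Cw δw) (μ ν : Fin 4)
    (hlawΔ : ∀ j : ℕ, 1 ≤ j → ∀ (μ ν : Fin 4) (z : Fin 4 → ℤ),
      hessKer (AN (Roots.ctr Lc) j) (VN (Roots.ctr Lc) P j) (WN (Roots.ctr Lc) P j + 𝒲Δ j) μ ν z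
        = hessKer (AF j) (𝒱F j) (𝒲F j) μ ν z + hessKer (AG j) (𝒱G j) (𝒲G j) μ ν z)
    (hF₁ : ∀ (μ ν : Fin 4) (z : Fin 4 → ℤ),
      hessKer (AF 1) (𝒱F 1) (𝒲F 1) μ ν z
        = (Lc : ℝ) ^ 8 * dressedEntry (wStep Lc 1) (TshotOf Lc (JcComp hLc N cΛ cB (Roots.ctr Lc) P) 1) ((Lc : ℤ) • z) μ ν)
    (htrΔ : ∀ j : ℕ, 1 ≤ j → ∀ (μ ν : Fin 4) (z : Fin 4 → ℤ),
      hessKer (AF (j + 1)) (𝒱F (j + 1)) (𝒲F (j + 1)) μ ν z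
        = (Lc : ℝ) ^ 8 * dressedEntry (wStep Lc (j + 1))
            (hessKer (AN (Roots.ctr Lc) j) (VN (Roots.ctr Lc) P j) (WN (Roots.ctr Lc) P j + 𝒲Δ j)) ((Lc : ℤ) • z) μ ν)
    (hG : ∀ j : ℕ, 1 ≤ j → ∀ (μ ν : Fin 4) (z : Fin 4 → ℤ),
      hessKer (AG j) (𝒱G j) (𝒲G j) μ ν z = TbalOf Lc (JsB12CombShSym hLc N (symTablesAn1S2 3 Lc cΛ) cΛ cB) j μ ν z)
    (hT0 : ∀ j (c e : Fin 4), HasSum (TbalOf Lc (JsB12CombShSym hLc N (symTablesAn1S2 3 Lc cΛ) cΛ cB) j c e) 0)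
    (hT1 : ∀ j (c e ρ : Fin 4), HasSum (fun t : Fin 4 → ℤ => t ρ • TbalOf Lc (JsB12CombShSym hLc N (symTablesAn1S2 3 Lc cΛ) cΛ cB) j c e t) 0)
    (hDΔtr : ∀ j : ℕ, 1 ≤ j → ∀ (μ ν : Fin 4) (z : Fin 4 → ℤ),
      -(1 / 2 : ℝ) * tadpole (AN (Roots.ctr Lc) (j + 1)) (𝒲Δ (j + 1) μ 0 ν z)
        = (Lc : ℝ) ^ 8 * dressedEntry (wStep Lc (j + 1))
            (fun c e t => -(1 / 2 : ℝ) * tadpole (AN (Roots.ctr Lc) j) (𝒲Δ j c 0 e t)) ((Lc : ℤ) • z) μ ν)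
    (S : Fin (3 + 1) → Site (3 + 1) → Fin (3 + 1) → Site (3 + 1) → ℝ) (τ : Fin (3 + 1) → Site (3 + 1) → V →ₗ[ℝ] ℝ) (lam : Fin (3 + 1) → Site (3 + 1) → V)
    (c : Fin (3 + 1) → Site (3 + 1) →+ ℝ) (hcz : ∀ (ρ : Fin (3 + 1)) (z : Site (3 + 1)), c ρ z = (z ρ : ℝ))
    (hS : ∀ (ν : Fin (3 + 1)) (z : Site (3 + 1)) (κ : Fin (3 + 1)) (y : Site (3 + 1)), S ν z κ y = S ν 0 κ (y - z))
    (hτ : ∀ (κ : Fin (3 + 1)) (y : Site (3 + 1)) (μ : Fin (3 + 1)) (z : Site (3 + 1)), τ κ y (lam μ z) = τ κ (y - z) (lam μ 0))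
    (hSa : ∀ (ν κ : Fin (3 + 1)), AbsMoment₂ (fun w => S ν 0 κ w)) (hτa : ∀ (κ μ : Fin (3 + 1)), AbsMoment₂ (fun y => τ κ y (lam μ 0)))
    (hΘ : ∀ (κ μ : Fin (3 + 1)), ∑' y, τ κ y (lam μ 0) = 0)
    (hS0 : ∀ (ν κ : Fin (3 + 1)), ∑' w, S ν 0 κ w = 0)
    (hS1 : ∀ (ρ ν κ : Fin (3 + 1)), ∑' w, c ρ w * S ν 0 κ w = 0)
    (hX : ∀ (μ ν : Fin (3 + 1)) (z : Site (3 + 1)),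
      tadpole (AN (Roots.ctr Lc) 1) (𝒲Δ 1 μ 0 ν z) = ∑ κ, ∑' y, (S ν z κ y * τ κ y (lam μ 0) + S μ 0 κ y * τ κ y (lam ν z))) :
    D1Sum Lc (JsB12CombShSym hLc N (symTablesAn1S2 3 Lc cΛ) cΛ cB) (JcComp hLc N cΛ cB (Roots.ctr Lc) P) μ ν := by
  have hc1 : ∀ (ρ : Fin (3 + 1)) (z : Site (3 + 1)), |c ρ z| ≤ 1 * l1 z := abs_coordHom_le_l1 c hcz
  refine d1Sum_JcComp_ctr_nested_of_fedW_moments_fed_wStep hLc N cΛ cB P AF 𝒱F 𝒲F AG 𝒱G 𝒲G 𝒲Δ hWΔ₂ μ ν hlawΔ hF₁ htrΔ hG hT0 hT1 hDΔtr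
    (fun μ' ν' => tsum_tadpole_eq_zero_of_tsum (tsum_symPairing_eq_zero S τ lam hS hτ hSa hτa hΘ μ' ν') (hX μ' ν'))
    (fun μ' ν' ρ => ?_) ?_
  · have h := tsum_firstMoment_symPairing_eq_zero_of_colSums_eq_zero S τ lam hS hτ hSa hτa hΘ hS0 (c ρ) zero_le_one (hc1 ρ) μ' ν'
    simp only [hcz] at h
    exact tsum_weight_tadpole_eq_zero_of_hasSum h (hX μ' ν')
  · have h := tsum_secondMoment_symPairing_eq_zero_of_dipoles_eq_zero S τ lam hS hτ hSa hτa hΘ hS0 (c μ) (c ν) zero_le_one zero_le_one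
      (hc1 μ) (hc1 ν) (hS1 μ) (hS1 ν) μ ν
    simp only [hcz] at h
    exact tsum_weight_tadpole_eq_zero_of_hasSum h (hX μ ν)

end BaseSummable

/-! ## §3 Per-storey shape, summable cut -/

section PerStoreySummable

variable {Lc : ℕ} [NeZero Lc] {FF FG : Type*} [Fintype FF] [Fintype FG]
variable {V : ℕ → Type*} [∀ j, AddCommGroup (V j)] [∀ j, Module ℝ (V j)]

/-- [folklore] **THE PER-STOREY SHAPE, SUMMABLE CUT** (p659244 §2 shape; general roots `Rt`; NO covariance row): at EVERY storey `j ≥ 1` the pairing data `S j`, `τ j`, `lam j` (space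
`V j`), covariance, `hSa hτa`, (U) `hΘ j`, `hS0 j`, `hS1 j`, `hX j`; coordinates `c ρ` storey-free. -/
theorem d1Tel_JcComp_nested_of_fedW_pairingSummable_wStep (hLc : Odd Lc) (N : ℕ) (cΛ cB : ℝ) (Rt : Roots Lc) (P : Pins)
    (AF : ℕ → MKer 4 FF) (𝒱F : ℕ → Fin 4 → (Fin 4 → ℤ) → MKer 4 FF) (𝒲F : ℕ → Fin 4 → (Fin 4 → ℤ) → Fin 4 → (Fin 4 → ℤ) → MKer 4 FF)
    (AG : ℕ → MKer 4 FG) (𝒱G : ℕ → Fin 4 → (Fin 4 → ℤ) → MKer 4 FG) (𝒲G : ℕ → Fin 4 → (Fin 4 → ℤ) → Fin 4 → (Fin 4 → ℤ) → MKer 4 FG)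
    (𝒲Δ : ℕ → Fin (3 + 1) → Site (3 + 1) → Fin (3 + 1) → Site (3 + 1) → MKer (3 + 1) (Fib 3))
    (hWΔ₂ : ∀ j : ℕ, ∃ Cw δw : ℝ, 0 < δw ∧ VertexFamily₂ (𝒲Δ j) (Lc ^ (j + 1)) Cw δw)
    (hlawΔ : ∀ j : ℕ, 1 ≤ j → ∀ (μ ν : Fin 4) (z : Fin 4 → ℤ),
      hessKer (AN Rt j) (VN Rt P j) (WN Rt P j + 𝒲Δ j) μ ν z
        = hessKer (AF j) (𝒱F j) (𝒲F j) μ ν z + hessKer (AG j) (𝒱G j) (𝒲G j) μ ν z)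
    (hF₁ : ∀ (μ ν : Fin 4) (z : Fin 4 → ℤ),
      hessKer (AF 1) (𝒱F 1) (𝒲F 1) μ ν z
        = (Lc : ℝ) ^ 8 * dressedEntry (wStep Lc 1) (TshotOf Lc (JcComp hLc N cΛ cB Rt P) 1) ((Lc : ℤ) • z) μ ν)
    (htr : ∀ j : ℕ, 1 ≤ j → ∀ (μ ν : Fin 4) (z : Fin 4 → ℤ),
      hessKer (AF (j + 1)) (𝒱F (j + 1)) (𝒲F (j + 1)) μ ν z
        = (Lc : ℝ) ^ 8 * dressedEntry (wStep Lc (j + 1)) (hessKer (AN Rt j) (VN Rt P j) (WN Rt P j)) ((Lc : ℤ) • z) μ ν)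
    (hG : ∀ j : ℕ, 1 ≤ j → ∀ (μ ν : Fin 4) (z : Fin 4 → ℤ),
      hessKer (AG j) (𝒱G j) (𝒲G j) μ ν z = TbalOf Lc (JsB12CombShSym hLc N (symTablesAn1S2 3 Lc cΛ) cΛ cB) j μ ν z)
    (hT0 : ∀ j (c e : Fin 4), HasSum (TbalOf Lc (JsB12CombShSym hLc N (symTablesAn1S2 3 Lc cΛ) cΛ cB) j c e) 0)
    (hT1 : ∀ j (c e ρ : Fin 4), HasSum (fun t : Fin 4 → ℤ => t ρ • TbalOf Lc (JsB12CombShSym hLc N (symTablesAn1S2 3 Lc cΛ) cΛ cB) j c e t) 0)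
    (S : ℕ → Fin (3 + 1) → Site (3 + 1) → Fin (3 + 1) → Site (3 + 1) → ℝ) (τ : ∀ j : ℕ, Fin (3 + 1) → Site (3 + 1) → V j →ₗ[ℝ] ℝ)
    (lam : ∀ j : ℕ, Fin (3 + 1) → Site (3 + 1) → V j)
    (c : Fin (3 + 1) → Site (3 + 1) →+ ℝ) (hcz : ∀ (ρ : Fin (3 + 1)) (z : Site (3 + 1)), c ρ z = (z ρ : ℝ))
    (hS : ∀ j (ν : Fin (3 + 1)) (z : Site (3 + 1)) (κ : Fin (3 + 1)) (y : Site (3 + 1)), S j ν z κ y = S j ν 0 κ (y - z))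
    (hτ : ∀ j (κ : Fin (3 + 1)) (y : Site (3 + 1)) (μ : Fin (3 + 1)) (z : Site (3 + 1)), τ j κ y (lam j μ z) = τ j κ (y - z) (lam j μ 0))
    (hSa : ∀ j (ν κ : Fin (3 + 1)), AbsMoment₂ (fun w => S j ν 0 κ w)) (hτa : ∀ j (κ μ : Fin (3 + 1)), AbsMoment₂ (fun y => τ j κ y (lam j μ 0)))
    (hΘ : ∀ j (κ μ : Fin (3 + 1)), ∑' y, τ j κ y (lam j μ 0) = 0)
    (hS0 : ∀ j (ν κ : Fin (3 + 1)), ∑' w, S j ν 0 κ w = 0)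
    (hS1 : ∀ j (ρ ν κ : Fin (3 + 1)), ∑' w, c ρ w * S j ν 0 κ w = 0)
    (hX : ∀ j : ℕ, 1 ≤ j → ∀ (μ ν : Fin (3 + 1)) (z : Site (3 + 1)),
      tadpole (AN Rt j) (𝒲Δ j μ 0 ν z) = ∑ κ, ∑' y, (S j ν z κ y * τ j κ y (lam j μ 0) + S j μ 0 κ y * τ j κ y (lam j ν z))) :
    D1Tel Lc (JsB12CombShSym hLc N (symTablesAn1S2 3 Lc cΛ) cΛ cB) (JcComp hLc N cΛ cB Rt P) := by
  have hc1 : ∀ (ρ : Fin (3 + 1)) (z : Site (3 + 1)), |c ρ z| ≤ 1 * l1 z := abs_coordHom_le_l1 c hcz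
  refine d1Tel_JcComp_nested_of_fedW_moments_wStep hLc N cΛ cB Rt P AF 𝒱F 𝒲F AG 𝒱G 𝒲G 𝒲Δ hWΔ₂ hlawΔ hF₁ htr hG hT0 hT1
    (fun j hj μ ν => tsum_tadpole_eq_zero_of_tsum
      (tsum_symPairing_eq_zero (S j) (τ j) (lam j) (hS j) (hτ j) (hSa j) (hτa j) (hΘ j) μ ν) (hX j hj μ ν))
    (fun j hj μ ν ρ => ?_) (fun j hj κ l μ ν => ?_)
  · have h := tsum_firstMoment_symPairing_eq_zero_of_colSums_eq_zero (S j) (τ j) (lam j) (hS j) (hτ j) (hSa j) (hτa j) (hΘ j) (hS0 j)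
      (c ρ) zero_le_one (hc1 ρ) μ ν
    simp only [hcz] at h
    exact tsum_weight_tadpole_eq_zero_of_hasSum h (hX j hj μ ν)
  · have h := tsum_secondMoment_symPairing_eq_zero_of_dipoles_eq_zero (S j) (τ j) (lam j) (hS j) (hτ j) (hSa j) (hτa j) (hΘ j) (hS0 j)
      (c κ) (c l) zero_le_one zero_le_one (hc1 κ) (hc1 l) (hS1 j κ) (hS1 j l) μ ν
    simp only [hcz] at h
    exact tsum_weight_tadpole_eq_zero_of_hasSum h (hX j hj μ ν)

end PerStoreySummable

/-! ## §4 Base-only shape, summable cut, (C) and (R) displayed (an2 PART 44 by name) -/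

section BaseCoclosed
variable {Lc : ℕ} [NeZero Lc] {FF FG : Type*} [Fintype FF] [Fintype FG] {V : Type*} [AddCommGroup V] [Module ℝ V]

/-- [folklore] **THE BASE END, SUMMABLE CUT, WITH (U)(C)(R) THEMSELVES**: §2 with `hS0 hS1` REPLACED by unit steps `e` (`hce`), (C) `hdiv` pointwise on `ℤ⁴`, (R) mirrors `R ν ρ`
(`ρ ≠ ν`) fixing the components `κ ≠ ρ` and flipping `c ρ` affinely — `hS0 hS1` inside by an2 PART 44 ⟹ `D1Tel`. -/
theorem d1Tel_JcComp_ctr_nested_of_fedW_pairingCoclosed_fed_wStep (hLc : Odd Lc) (N : ℕ) (cΛ cB : ℝ) (P : Pins)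
    (AF : ℕ → MKer 4 FF) (𝒱F : ℕ → Fin 4 → (Fin 4 → ℤ) → MKer 4 FF) (𝒲F : ℕ → Fin 4 → (Fin 4 → ℤ) → Fin 4 → (Fin 4 → ℤ) → MKer 4 FF)
    (AG : ℕ → MKer 4 FG) (𝒱G : ℕ → Fin 4 → (Fin 4 → ℤ) → MKer 4 FG) (𝒲G : ℕ → Fin 4 → (Fin 4 → ℤ) → Fin 4 → (Fin 4 → ℤ) → MKer 4 FG)
    (𝒲Δ : ℕ → Fin (3 + 1) → Site (3 + 1) → Fin (3 + 1) → Site (3 + 1) → MKer (3 + 1) (Fib 3))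
    (hWΔ₂ : ∀ j : ℕ, ∃ Cw δw : ℝ, 0 < δw ∧ VertexFamily₂ (𝒲Δ j) (Lc ^ (j + 1)) Cw δw)
    (hlawΔ : ∀ j : ℕ, 1 ≤ j → ∀ (μ ν : Fin 4) (z : Fin 4 → ℤ),
      hessKer (AN (Roots.ctr Lc) j) (VN (Roots.ctr Lc) P j) (WN (Roots.ctr Lc) P j + 𝒲Δ j) μ ν z
        = hessKer (AF j) (𝒱F j) (𝒲F j) μ ν z + hessKer (AG j) (𝒱G j) (𝒲G j) μ ν z)
    (hF₁ : ∀ (μ ν : Fin 4) (z : Fin 4 → ℤ),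
      hessKer (AF 1) (𝒱F 1) (𝒲F 1) μ ν z
        = (Lc : ℝ) ^ 8 * dressedEntry (wStep Lc 1) (TshotOf Lc (JcComp hLc N cΛ cB (Roots.ctr Lc) P) 1) ((Lc : ℤ) • z) μ ν)
    (htrΔ : ∀ j : ℕ, 1 ≤ j → ∀ (μ ν : Fin 4) (z : Fin 4 → ℤ),
      hessKer (AF (j + 1)) (𝒱F (j + 1)) (𝒲F (j + 1)) μ ν z
        = (Lc : ℝ) ^ 8 * dressedEntry (wStep Lc (j + 1))
            (hessKer (AN (Roots.ctr Lc) j) (VN (Roots.ctr Lc) P j) (WN (Roots.ctr Lc) P j + 𝒲Δ j)) ((Lc : ℤ) • z) μ ν)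
    (hG : ∀ j : ℕ, 1 ≤ j → ∀ (μ ν : Fin 4) (z : Fin 4 → ℤ),
      hessKer (AG j) (𝒱G j) (𝒲G j) μ ν z = TbalOf Lc (JsB12CombShSym hLc N (symTablesAn1S2 3 Lc cΛ) cΛ cB) j μ ν z)
    (hT0 : ∀ j (c e : Fin 4), HasSum (TbalOf Lc (JsB12CombShSym hLc N (symTablesAn1S2 3 Lc cΛ) cΛ cB) j c e) 0)
    (hT1 : ∀ j (c e ρ : Fin 4), HasSum (fun t : Fin 4 → ℤ => t ρ • TbalOf Lc (JsB12CombShSym hLc N (symTablesAn1S2 3 Lc cΛ) cΛ cB) j c e t) 0)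
    (hDΔtr : ∀ j : ℕ, 1 ≤ j → ∀ (μ ν : Fin 4) (z : Fin 4 → ℤ),
      -(1 / 2 : ℝ) * tadpole (AN (Roots.ctr Lc) (j + 1)) (𝒲Δ (j + 1) μ 0 ν z)
        = (Lc : ℝ) ^ 8 * dressedEntry (wStep Lc (j + 1))
            (fun c e t => -(1 / 2 : ℝ) * tadpole (AN (Roots.ctr Lc) j) (𝒲Δ j c 0 e t)) ((Lc : ℤ) • z) μ ν)
    (S : Fin (3 + 1) → Site (3 + 1) → Fin (3 + 1) → Site (3 + 1) → ℝ) (τ : Fin (3 + 1) → Site (3 + 1) → V →ₗ[ℝ] ℝ) (lam : Fin (3 + 1) → Site (3 + 1) → V)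
    (c : Fin (3 + 1) → Site (3 + 1) →+ ℝ) (hcz : ∀ (ρ : Fin (3 + 1)) (z : Site (3 + 1)), c ρ z = (z ρ : ℝ))
    (e : Fin (3 + 1) → Site (3 + 1)) (hce : ∀ (ρ κ : Fin (3 + 1)), c ρ (e κ) = if κ = ρ then 1 else 0)
    (hS : ∀ (ν : Fin (3 + 1)) (z : Site (3 + 1)) (κ : Fin (3 + 1)) (y : Site (3 + 1)), S ν z κ y = S ν 0 κ (y - z))
    (hτ : ∀ (κ : Fin (3 + 1)) (y : Site (3 + 1)) (μ : Fin (3 + 1)) (z : Site (3 + 1)), τ κ y (lam μ z) = τ κ (y - z) (lam μ 0))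
    (hSa : ∀ (ν κ : Fin (3 + 1)), AbsMoment₂ (fun w => S ν 0 κ w)) (hτa : ∀ (κ μ : Fin (3 + 1)), AbsMoment₂ (fun y => τ κ y (lam μ 0)))
    -- (U) no door word on the summed gauge column
    (hΘ : ∀ (κ μ : Fin (3 + 1)), ∑' y, τ κ y (lam μ 0) = 0)
    -- (C) every read-out column is co-closed, pointwise on ℤ⁴
    (hdiv : ∀ (ν : Fin (3 + 1)) (y : Site (3 + 1)), ∑ κ, (S ν 0 κ y - S ν 0 κ (y - e κ)) = 0)
    -- (R) the mirrors transverse to the source direction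
    (R : Fin (3 + 1) → Fin (3 + 1) → Site (3 + 1) ≃ Site (3 + 1)) (k : Fin (3 + 1) → Fin (3 + 1) → ℝ)
    (hRA : ∀ (ν ρ : Fin (3 + 1)), ρ ≠ ν → ∀ κ, κ ≠ ρ → ∀ w, S ν 0 κ (R ν ρ w) = S ν 0 κ w)
    (hRc : ∀ (ν ρ : Fin (3 + 1)), ρ ≠ ν → ∀ w, c ρ (R ν ρ w) = k ν ρ - c ρ w)
    (hX : ∀ (μ ν : Fin (3 + 1)) (z : Site (3 + 1)),
      tadpole (AN (Roots.ctr Lc) 1) (𝒲Δ 1 μ 0 ν z) = ∑ κ, ∑' y, (S ν z κ y * τ κ y (lam μ 0) + S μ 0 κ y * τ κ y (lam ν z))) :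
    D1Tel Lc (JsB12CombShSym hLc N (symTablesAn1S2 3 Lc cΛ) cΛ cB) (JcComp hLc N cΛ cB (Roots.ctr Lc) P) := by
  have hc1 : ∀ (ρ : Fin (3 + 1)) (z : Site (3 + 1)), |c ρ z| ≤ 1 * l1 z := abs_coordHom_le_l1 c hcz
  have hS0 : ∀ (ν κ : Fin (3 + 1)), ∑' w, S ν 0 κ w = 0 := fun ν κ =>
    tsum_col_eq_zero_of_coclosed e (fun κ' w => S ν 0 κ' w) (hSa ν) (hdiv ν) (c κ) zero_le_one (hc1 κ) κ (hce κ)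
  have hS1 : ∀ (ρ ν κ : Fin (3 + 1)), ∑' w, c ρ w * S ν 0 κ w = 0 := fun ρ ν κ =>
    tsum_dipoles_eq_zero_of_coclosed_of_reflect e (fun κ' w => S ν 0 κ' w) (hSa ν) (hdiv ν) c zero_le_one hc1 hce ν (R ν) (hRA ν) (k ν) (hRc ν) ρ κ
  exact d1Tel_JcComp_ctr_nested_of_fedW_pairingSummable_fed_wStep hLc N cΛ cB P AF 𝒱F 𝒲F AG 𝒱G 𝒲G 𝒲Δ hWΔ₂ hlawΔ hF₁ htrΔ hG hT0 hT1 hDΔtr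
    S τ lam c hcz hS hτ hSa hτa hΘ hS0 hS1 hX

/-- [folklore] **THE READ-OUT-LEVEL TWIN** (channel `(μ, ν)`) of §4. -/
theorem d1Sum_JcComp_ctr_nested_of_fedW_pairingCoclosed_fed_wStep (hLc : Odd Lc) (N : ℕ) (cΛ cB : ℝ) (P : Pins)
    (AF : ℕ → MKer 4 FF) (𝒱F : ℕ → Fin 4 → (Fin 4 → ℤ) → MKer 4 FF) (𝒲F : ℕ → Fin 4 → (Fin 4 → ℤ) → Fin 4 → (Fin 4 → ℤ) → MKer 4 FF)
    (AG : ℕ → MKer 4 FG) (𝒱G : ℕ → Fin 4 → (Fin 4 → ℤ) → MKer 4 FG) (𝒲G : ℕ → Fin 4 → (Fin 4 → ℤ) → Fin 4 → (Fin 4 → ℤ) → MKer 4 FG)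
    (𝒲Δ : ℕ → Fin (3 + 1) → Site (3 + 1) → Fin (3 + 1) → Site (3 + 1) → MKer (3 + 1) (Fib 3))
    (hWΔ₂ : ∀ j : ℕ, ∃ Cw δw : ℝ, 0 < δw ∧ VertexFamily₂ (𝒲Δ j) (Lc ^ (j + 1)) Cw δw) (μ ν : Fin 4)
    (hlawΔ : ∀ j : ℕ, 1 ≤ j → ∀ (μ ν : Fin 4) (z : Fin 4 → ℤ),
      hessKer (AN (Roots.ctr Lc) j) (VN (Roots.ctr Lc) P j) (WN (Roots.ctr Lc) P j + 𝒲Δ j) μ ν z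
        = hessKer (AF j) (𝒱F j) (𝒲F j) μ ν z + hessKer (AG j) (𝒱G j) (𝒲G j) μ ν z)
    (hF₁ : ∀ (μ ν : Fin 4) (z : Fin 4 → ℤ),
      hessKer (AF 1) (𝒱F 1) (𝒲F 1) μ ν z
        = (Lc : ℝ) ^ 8 * dressedEntry (wStep Lc 1) (TshotOf Lc (JcComp hLc N cΛ cB (Roots.ctr Lc) P) 1) ((Lc : ℤ) • z) μ ν)
    (htrΔ : ∀ j : ℕ, 1 ≤ j → ∀ (μ ν : Fin 4) (z : Fin 4 → ℤ),
      hessKer (AF (j + 1)) (𝒱F (j + 1)) (𝒲F (j + 1)) μ ν z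
        = (Lc : ℝ) ^ 8 * dressedEntry (wStep Lc (j + 1))
            (hessKer (AN (Roots.ctr Lc) j) (VN (Roots.ctr Lc) P j) (WN (Roots.ctr Lc) P j + 𝒲Δ j)) ((Lc : ℤ) • z) μ ν)
    (hG : ∀ j : ℕ, 1 ≤ j → ∀ (μ ν : Fin 4) (z : Fin 4 → ℤ),
      hessKer (AG j) (𝒱G j) (𝒲G j) μ ν z = TbalOf Lc (JsB12CombShSym hLc N (symTablesAn1S2 3 Lc cΛ) cΛ cB) j μ ν z)
    (hT0 : ∀ j (c e : Fin 4), HasSum (TbalOf Lc (JsB12CombShSym hLc N (symTablesAn1S2 3 Lc cΛ) cΛ cB) j c e) 0)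
    (hT1 : ∀ j (c e ρ : Fin 4), HasSum (fun t : Fin 4 → ℤ => t ρ • TbalOf Lc (JsB12CombShSym hLc N (symTablesAn1S2 3 Lc cΛ) cΛ cB) j c e t) 0)
    (hDΔtr : ∀ j : ℕ, 1 ≤ j → ∀ (μ ν : Fin 4) (z : Fin 4 → ℤ),
      -(1 / 2 : ℝ) * tadpole (AN (Roots.ctr Lc) (j + 1)) (𝒲Δ (j + 1) μ 0 ν z)
        = (Lc : ℝ) ^ 8 * dressedEntry (wStep Lc (j + 1))
            (fun c e t => -(1 / 2 : ℝ) * tadpole (AN (Roots.ctr Lc) j) (𝒲Δ j c 0 e t)) ((Lc : ℤ) • z) μ ν)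
    (S : Fin (3 + 1) → Site (3 + 1) → Fin (3 + 1) → Site (3 + 1) → ℝ) (τ : Fin (3 + 1) → Site (3 + 1) → V →ₗ[ℝ] ℝ) (lam : Fin (3 + 1) → Site (3 + 1) → V)
    (c : Fin (3 + 1) → Site (3 + 1) →+ ℝ) (hcz : ∀ (ρ : Fin (3 + 1)) (z : Site (3 + 1)), c ρ z = (z ρ : ℝ))
    (e : Fin (3 + 1) → Site (3 + 1)) (hce : ∀ (ρ κ : Fin (3 + 1)), c ρ (e κ) = if κ = ρ then 1 else 0)
    (hS : ∀ (ν : Fin (3 + 1)) (z : Site (3 + 1)) (κ : Fin (3 + 1)) (y : Site (3 + 1)), S ν z κ y = S ν 0 κ (y - z))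
    (hτ : ∀ (κ : Fin (3 + 1)) (y : Site (3 + 1)) (μ : Fin (3 + 1)) (z : Site (3 + 1)), τ κ y (lam μ z) = τ κ (y - z) (lam μ 0))
    (hSa : ∀ (ν κ : Fin (3 + 1)), AbsMoment₂ (fun w => S ν 0 κ w)) (hτa : ∀ (κ μ : Fin (3 + 1)), AbsMoment₂ (fun y => τ κ y (lam μ 0)))
    (hΘ : ∀ (κ μ : Fin (3 + 1)), ∑' y, τ κ y (lam μ 0) = 0)
    (hdiv : ∀ (ν : Fin (3 + 1)) (y : Site (3 + 1)), ∑ κ, (S ν 0 κ y - S ν 0 κ (y - e κ)) = 0)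
    (R : Fin (3 + 1) → Fin (3 + 1) → Site (3 + 1) ≃ Site (3 + 1)) (k : Fin (3 + 1) → Fin (3 + 1) → ℝ)
    (hRA : ∀ (ν ρ : Fin (3 + 1)), ρ ≠ ν → ∀ κ, κ ≠ ρ → ∀ w, S ν 0 κ (R ν ρ w) = S ν 0 κ w)
    (hRc : ∀ (ν ρ : Fin (3 + 1)), ρ ≠ ν → ∀ w, c ρ (R ν ρ w) = k ν ρ - c ρ w)
    (hX : ∀ (μ ν : Fin (3 + 1)) (z : Site (3 + 1)),
      tadpole (AN (Roots.ctr Lc) 1) (𝒲Δ 1 μ 0 ν z) = ∑ κ, ∑' y, (S ν z κ y * τ κ y (lam μ 0) + S μ 0 κ y * τ κ y (lam ν z))) :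
    D1Sum Lc (JsB12CombShSym hLc N (symTablesAn1S2 3 Lc cΛ) cΛ cB) (JcComp hLc N cΛ cB (Roots.ctr Lc) P) μ ν := by
  have hc1 : ∀ (ρ : Fin (3 + 1)) (z : Site (3 + 1)), |c ρ z| ≤ 1 * l1 z := abs_coordHom_le_l1 c hcz
  have hS0 : ∀ (ν κ : Fin (3 + 1)), ∑' w, S ν 0 κ w = 0 := fun ν κ =>
    tsum_col_eq_zero_of_coclosed e (fun κ' w => S ν 0 κ' w) (hSa ν) (hdiv ν) (c κ) zero_le_one (hc1 κ) κ (hce κ)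
  have hS1 : ∀ (ρ ν κ : Fin (3 + 1)), ∑' w, c ρ w * S ν 0 κ w = 0 := fun ρ ν κ =>
    tsum_dipoles_eq_zero_of_coclosed_of_reflect e (fun κ' w => S ν 0 κ' w) (hSa ν) (hdiv ν) c zero_le_one hc1 hce ν (R ν) (hRA ν) (k ν) (hRc ν) ρ κ
  exact d1Sum_JcComp_ctr_nested_of_fedW_pairingSummable_fed_wStep hLc N cΛ cB P AF 𝒱F 𝒲F AG 𝒱G 𝒲G 𝒲Δ hWΔ₂ μ ν hlawΔ hF₁ htrΔ hG hT0 hT1 hDΔtr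
    S τ lam c hcz hS hτ hSa hτa hΘ hS0 hS1 hX

end BaseCoclosed

/-! ## §5 Per-storey shape, summable cut, (C) and (R) displayed -/

section PerStoreyCoclosed
variable {Lc : ℕ} [NeZero Lc] {FF FG : Type*} [Fintype FF] [Fintype FG]
variable {V : ℕ → Type*} [∀ j, AddCommGroup (V j)] [∀ j, Module ℝ (V j)]

/-- [folklore] **THE PER-STOREY END, SUMMABLE CUT, WITH (U)(C)(R) THEMSELVES** at every storey (storey-indexed `hdiv j`, mirrors `R j ν ρ`, offsets `k j ν ρ`; `e`, `c` storey-free). -/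
theorem d1Tel_JcComp_nested_of_fedW_pairingCoclosed_wStep (hLc : Odd Lc) (N : ℕ) (cΛ cB : ℝ) (Rt : Roots Lc) (P : Pins)
    (AF : ℕ → MKer 4 FF) (𝒱F : ℕ → Fin 4 → (Fin 4 → ℤ) → MKer 4 FF) (𝒲F : ℕ → Fin 4 → (Fin 4 → ℤ) → Fin 4 → (Fin 4 → ℤ) → MKer 4 FF)
    (AG : ℕ → MKer 4 FG) (𝒱G : ℕ → Fin 4 → (Fin 4 → ℤ) → MKer 4 FG) (𝒲G : ℕ → Fin 4 → (Fin 4 → ℤ) → Fin 4 → (Fin 4 → ℤ) → MKer 4 FG)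
    (𝒲Δ : ℕ → Fin (3 + 1) → Site (3 + 1) → Fin (3 + 1) → Site (3 + 1) → MKer (3 + 1) (Fib 3))
    (hWΔ₂ : ∀ j : ℕ, ∃ Cw δw : ℝ, 0 < δw ∧ VertexFamily₂ (𝒲Δ j) (Lc ^ (j + 1)) Cw δw)
    (hlawΔ : ∀ j : ℕ, 1 ≤ j → ∀ (μ ν : Fin 4) (z : Fin 4 → ℤ),
      hessKer (AN Rt j) (VN Rt P j) (WN Rt P j + 𝒲Δ j) μ ν z
        = hessKer (AF j) (𝒱F j) (𝒲F j) μ ν z + hessKer (AG j) (𝒱G j) (𝒲G j) μ ν z)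
    (hF₁ : ∀ (μ ν : Fin 4) (z : Fin 4 → ℤ),
      hessKer (AF 1) (𝒱F 1) (𝒲F 1) μ ν z
        = (Lc : ℝ) ^ 8 * dressedEntry (wStep Lc 1) (TshotOf Lc (JcComp hLc N cΛ cB Rt P) 1) ((Lc : ℤ) • z) μ ν)
    (htr : ∀ j : ℕ, 1 ≤ j → ∀ (μ ν : Fin 4) (z : Fin 4 → ℤ),
      hessKer (AF (j + 1)) (𝒱F (j + 1)) (𝒲F (j + 1)) μ ν z
        = (Lc : ℝ) ^ 8 * dressedEntry (wStep Lc (j + 1)) (hessKer (AN Rt j) (VN Rt P j) (WN Rt P j)) ((Lc : ℤ) • z) μ ν)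
    (hG : ∀ j : ℕ, 1 ≤ j → ∀ (μ ν : Fin 4) (z : Fin 4 → ℤ),
      hessKer (AG j) (𝒱G j) (𝒲G j) μ ν z = TbalOf Lc (JsB12CombShSym hLc N (symTablesAn1S2 3 Lc cΛ) cΛ cB) j μ ν z)
    (hT0 : ∀ j (c e : Fin 4), HasSum (TbalOf Lc (JsB12CombShSym hLc N (symTablesAn1S2 3 Lc cΛ) cΛ cB) j c e) 0)
    (hT1 : ∀ j (c e ρ : Fin 4), HasSum (fun t : Fin 4 → ℤ => t ρ • TbalOf Lc (JsB12CombShSym hLc N (symTablesAn1S2 3 Lc cΛ) cΛ cB) j c e t) 0)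
    (S : ℕ → Fin (3 + 1) → Site (3 + 1) → Fin (3 + 1) → Site (3 + 1) → ℝ) (τ : ∀ j : ℕ, Fin (3 + 1) → Site (3 + 1) → V j →ₗ[ℝ] ℝ)
    (lam : ∀ j : ℕ, Fin (3 + 1) → Site (3 + 1) → V j)
    (c : Fin (3 + 1) → Site (3 + 1) →+ ℝ) (hcz : ∀ (ρ : Fin (3 + 1)) (z : Site (3 + 1)), c ρ z = (z ρ : ℝ))
    (e : Fin (3 + 1) → Site (3 + 1)) (hce : ∀ (ρ κ : Fin (3 + 1)), c ρ (e κ) = if κ = ρ then 1 else 0)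
    (hS : ∀ j (ν : Fin (3 + 1)) (z : Site (3 + 1)) (κ : Fin (3 + 1)) (y : Site (3 + 1)), S j ν z κ y = S j ν 0 κ (y - z))
    (hτ : ∀ j (κ : Fin (3 + 1)) (y : Site (3 + 1)) (μ : Fin (3 + 1)) (z : Site (3 + 1)), τ j κ y (lam j μ z) = τ j κ (y - z) (lam j μ 0))
    (hSa : ∀ j (ν κ : Fin (3 + 1)), AbsMoment₂ (fun w => S j ν 0 κ w)) (hτa : ∀ j (κ μ : Fin (3 + 1)), AbsMoment₂ (fun y => τ j κ y (lam j μ 0)))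
    (hΘ : ∀ j (κ μ : Fin (3 + 1)), ∑' y, τ j κ y (lam j μ 0) = 0)
    (hdiv : ∀ j (ν : Fin (3 + 1)) (y : Site (3 + 1)), ∑ κ, (S j ν 0 κ y - S j ν 0 κ (y - e κ)) = 0)
    (R : ℕ → Fin (3 + 1) → Fin (3 + 1) → Site (3 + 1) ≃ Site (3 + 1)) (k : ℕ → Fin (3 + 1) → Fin (3 + 1) → ℝ)
    (hRA : ∀ j (ν ρ : Fin (3 + 1)), ρ ≠ ν → ∀ κ, κ ≠ ρ → ∀ w, S j ν 0 κ (R j ν ρ w) = S j ν 0 κ w)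
    (hRc : ∀ j (ν ρ : Fin (3 + 1)), ρ ≠ ν → ∀ w, c ρ (R j ν ρ w) = k j ν ρ - c ρ w)
    (hX : ∀ j : ℕ, 1 ≤ j → ∀ (μ ν : Fin (3 + 1)) (z : Site (3 + 1)),
      tadpole (AN Rt j) (𝒲Δ j μ 0 ν z) = ∑ κ, ∑' y, (S j ν z κ y * τ j κ y (lam j μ 0) + S j μ 0 κ y * τ j κ y (lam j ν z))) :
    D1Tel Lc (JsB12CombShSym hLc N (symTablesAn1S2 3 Lc cΛ) cΛ cB) (JcComp hLc N cΛ cB Rt P) := by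
  have hc1 : ∀ (ρ : Fin (3 + 1)) (z : Site (3 + 1)), |c ρ z| ≤ 1 * l1 z := abs_coordHom_le_l1 c hcz
  have hS0 : ∀ j (ν κ : Fin (3 + 1)), ∑' w, S j ν 0 κ w = 0 := fun j ν κ =>
    tsum_col_eq_zero_of_coclosed e (fun κ' w => S j ν 0 κ' w) (hSa j ν) (hdiv j ν) (c κ) zero_le_one (hc1 κ) κ (hce κ)
  have hS1 : ∀ j (ρ ν κ : Fin (3 + 1)), ∑' w, c ρ w * S j ν 0 κ w = 0 := fun j ρ ν κ =>
    tsum_dipoles_eq_zero_of_coclosed_of_reflect e (fun κ' w => S j ν 0 κ' w) (hSa j ν) (hdiv j ν) c zero_le_one hc1 hce ν (R j ν) (hRA j ν) (k j ν)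
      (hRc j ν) ρ κ
  exact d1Tel_JcComp_nested_of_fedW_pairingSummable_wStep hLc N cΛ cB Rt P AF 𝒱F 𝒲F AG 𝒱G 𝒲G 𝒲Δ hWΔ₂ hlawΔ hF₁ htr hG hT0 hT1
    S τ lam c hcz hS hτ hSa hτa hΘ hS0 hS1 hX

end PerStoreyCoclosed

end Summit.QuantumFields.BalabanUV.Beta.FP.StepRecursionFeedNestedCompDoorPairingSummable

end
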